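import Literature.MathematicalPhysics.QuantumFieldTheory.Balaban1983to89.Beta.CompositionSingular

/-!
# `BalabanUV.Beta.FP.TiltDictionary` — road «FP» for binder row D1, row **GAMMA-2** (owner ruling R-FP-25, `HOME/b2b-balaban-beta-d1-p3/GAMMA-DESIGN.md` §2):
# THE LEG DICTIONARY OF ORGANISATION γ — the three blocks of the one shot's bordered inverse written through the TILTED (soft-constrained, invertible) form
# `K = H + QᵀAQ` and the EFFECTIVE FORM ONLY: `Q K⁻¹ Qᵀ = (effForm H Q + A)⁻¹`, `minOp H Q = K⁻¹Qᵀ(effForm H Q + A)`, `flucCov H Q = K⁻¹ − K⁻¹Qᵀ(effForm H Q + A)QK⁻¹`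
# ([folklore] corollary of the tree's `CompositionSingular.blocks_eq_of_reg`; nothing of the manuscripts)

HONEST DEPENDENCY (page 1, mandatory): continuum YM on T⁴ ⇐ BetaPertH ∧ nine spine estimates (0/9 proved); BetaPertH ⇐ (D1) ∧ (D4) ∧
CAP+tail; G-an2-4 gates asym, D1 and NE2/3/4.  HONEST FRAMING (cell contract, verbatim): «discharging `BetaPertH` makes Bałaban's UV
stability UNCONDITIONAL — a real constructive-QFT result; it is NOT the continuum limit and NOT the Clay problem.»  THIS MODULE is a twenty-line [folklore]
corollary of `Literature…Beta.CompositionSingular.blocks_eq_of_reg` («Bałaban's regularised reading», [Balaban1985BackgroundPropagators] (3.122)/(3.126) as orientation there);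
it defines nothing, cites nothing new, instantiates no object of Bałaban's, proves no estimate; 0 sorry.  NOT hbook, NOT D1, NOT BetaPertH, NOT continuum, NOT Clay.

ABSOLUTE RULE (cell charter, verbatim): «No internally-minted statement may enter as a cited fact. Every hypothesis is either kernel-proved in this
package or a verbatim quotation of a PUBLISHED theorem with page reference. The manuscript(s) under audit are NOT citable for their own disputed
steps — they are the thing under adjudication; programme-internal (2001/route/tribunal) claims are never citable.»

WHY (GAMMA-DESIGN §2).  In organisation γ the one shot is read off `kkt(H_cov, Q)⁻¹ = [[Γ, 𝓘],[𝓘ᵀ, −𝔊]]` and the road proves `𝔊 = effForm H_cov Q = n⁻⁴·Δ_∞^c` (EXPLICIT: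
`FP/SliceSaturation` + the fixed-point identity).  With the tilt `A := 1`, `K = H_cov + QᵀQ` is Bałaban's invertible `G⁻¹` of B5 (1.71) at `a = 1`, and this file's identities say
`Q G Qᵀ = (1 + 𝔊)⁻¹`, `𝓘 = G Qᵀ (1 + 𝔊)`, `Γ = G − G Qᵀ (1 + 𝔊) Q G`: every COARSE factor is the explicit `1 + 𝔊` — no coarse inverse has to be estimated; the only analytic leg data are
`G`, `GQᵀ`, `QG` (B5 Prop 1.2's printed kernels).  Hypotheses (displayed): `IsUnit K.det` and `IsUnit (blockProp K Q).det` (B5 (1.72)'s positivity at the road's instance, row IR-5′).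

CONTENT: `blockProp_tilt_inv_eq` (`(Q K⁻¹ Qᵀ)⁻¹ = effForm H Q + A`), `blockProp_tilt_eq` (`Q K⁻¹ Qᵀ = (effForm H Q + A)⁻¹`), `minOp_eq_tilt`, `flucCov_eq_tilt`, and the `A = 1` specialisations
`minOp_eq_tilt_one` ∕ `flucCov_eq_tilt_one` ∕ `blockProp_tilt_one_eq`.
Provenance: road FP OWNER b2b-balaban-beta-d1-p3 gen 6 (prover-b2b-balaban-beta-d1-p3-g6-0), 2026-08-21, row GAMMA-2.
-/

noncomputable section

namespace Summit.QuantumFields.BalabanUV.Beta.FP.TiltDictionary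

open Literature.MathematicalPhysics.QuantumFieldTheory.Balaban1983to89.Beta.Composition (kkt blockProp)
open Literature.MathematicalPhysics.QuantumFieldTheory.Balaban1983to89.Beta.CompositionSingular (effForm minOp flucCov blocks_eq_of_reg)
open scoped Matrix
open Matrix

variable {𝕜 : Type*} [Field 𝕜]
variable {ν μ : Type*} [Fintype ν] [Fintype μ] [DecidableEq ν] [DecidableEq μ]

/-- [folklore] **THE INVERSE BLOCK PROPAGATOR OF THE TILTED FORM IS THE EFFECTIVE FORM PLUS THE TILT**: `(Q K⁻¹ Qᵀ)⁻¹ = effForm H Q + A`, `K = H + QᵀAQ`. -/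
theorem blockProp_tilt_inv_eq (H : Matrix ν ν 𝕜) (Q : Matrix μ ν 𝕜) (A : Matrix μ μ 𝕜)
    (hK : IsUnit (H + Qᵀ * A * Q).det) (hP : IsUnit (blockProp (H + Qᵀ * A * Q) Q).det) :
    (blockProp (H + Qᵀ * A * Q) Q)⁻¹ = effForm H Q + A := by
  rw [(blocks_eq_of_reg H Q A hK hP).1, sub_add_cancel]

/-- [folklore] **`Q K⁻¹ Qᵀ = (effForm H Q + A)⁻¹`** (`K = H + QᵀAQ`; both sides invertible). -/
theorem blockProp_tilt_eq (H : Matrix ν ν 𝕜) (Q : Matrix μ ν 𝕜) (A : Matrix μ μ 𝕜)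
    (hK : IsUnit (H + Qᵀ * A * Q).det) (hP : IsUnit (blockProp (H + Qᵀ * A * Q) Q).det) :
    blockProp (H + Qᵀ * A * Q) Q = (effForm H Q + A)⁻¹ := by
  rw [← blockProp_tilt_inv_eq H Q A hK hP, Matrix.nonsing_inv_nonsing_inv _ hP]

/-- [folklore] **THE MINIMISER THROUGH THE TILT AND THE EFFECTIVE FORM**: `minOp H Q = K⁻¹ · Qᵀ · (effForm H Q + A)`. -/
theorem minOp_eq_tilt (H : Matrix ν ν 𝕜) (Q : Matrix μ ν 𝕜) (A : Matrix μ μ 𝕜)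
    (hK : IsUnit (H + Qᵀ * A * Q).det) (hP : IsUnit (blockProp (H + Qᵀ * A * Q) Q).det) :
    minOp H Q = (H + Qᵀ * A * Q)⁻¹ * Qᵀ * (effForm H Q + A) := by
  rw [(blocks_eq_of_reg H Q A hK hP).2.1, blockProp_tilt_inv_eq H Q A hK hP]

/-- [folklore] **THE FLUCTUATION COVARIANCE THROUGH THE TILT AND THE EFFECTIVE FORM**: `flucCov H Q = K⁻¹ − K⁻¹·Qᵀ·(effForm H Q + A)·Q·K⁻¹`. -/
theorem flucCov_eq_tilt (H : Matrix ν ν 𝕜) (Q : Matrix μ ν 𝕜) (A : Matrix μ μ 𝕜)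
    (hK : IsUnit (H + Qᵀ * A * Q).det) (hP : IsUnit (blockProp (H + Qᵀ * A * Q) Q).det) :
    flucCov H Q = (H + Qᵀ * A * Q)⁻¹ - (H + Qᵀ * A * Q)⁻¹ * Qᵀ * (effForm H Q + A) * Q * (H + Qᵀ * A * Q)⁻¹ := by
  rw [(blocks_eq_of_reg H Q A hK hP).2.2]
  unfold Literature.MathematicalPhysics.QuantumFieldTheory.Balaban1983to89.Beta.Envelope.constrProp
    Literature.MathematicalPhysics.QuantumFieldTheory.Balaban1983to89.Beta.Envelope.minMap
  rw [blockProp_tilt_inv_eq H Q A hK hP]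

/-! ## The unit tilt `A = 1` (Bałaban's `a = 1`, B5 (1.71); R-FP-24∕25) -/

/-- [folklore] `Q (H + QᵀQ)⁻¹ Qᵀ = (1 + effForm H Q)⁻¹`. -/
theorem blockProp_tilt_one_eq (H : Matrix ν ν 𝕜) (Q : Matrix μ ν 𝕜)
    (hK : IsUnit (H + Qᵀ * Q).det) (hP : IsUnit (blockProp (H + Qᵀ * Q) Q).det) :
    blockProp (H + Qᵀ * Q) Q = (1 + effForm H Q)⁻¹ := by
  have e : H + Qᵀ * (1 : Matrix μ μ 𝕜) * Q = H + Qᵀ * Q := by rw [Matrix.mul_one]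
  have hK' : IsUnit (H + Qᵀ * (1 : Matrix μ μ 𝕜) * Q).det := by rwa [e]
  have hP' : IsUnit (blockProp (H + Qᵀ * (1 : Matrix μ μ 𝕜) * Q) Q).det := by rwa [e]
  have h := blockProp_tilt_eq H Q 1 hK' hP'
  rw [e, add_comm (effForm H Q) (1 : Matrix μ μ 𝕜)] at h
  exact h

/-- [folklore] **`𝓘 = G Qᵀ (1 + 𝔊)`**: `minOp H Q = (H + QᵀQ)⁻¹ · Qᵀ · (1 + effForm H Q)`. -/
theorem minOp_eq_tilt_one (H : Matrix ν ν 𝕜) (Q : Matrix μ ν 𝕜)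
    (hK : IsUnit (H + Qᵀ * Q).det) (hP : IsUnit (blockProp (H + Qᵀ * Q) Q).det) :
    minOp H Q = (H + Qᵀ * Q)⁻¹ * Qᵀ * (1 + effForm H Q) := by
  have e : H + Qᵀ * (1 : Matrix μ μ 𝕜) * Q = H + Qᵀ * Q := by rw [Matrix.mul_one]
  have hK' : IsUnit (H + Qᵀ * (1 : Matrix μ μ 𝕜) * Q).det := by rwa [e]
  have hP' : IsUnit (blockProp (H + Qᵀ * (1 : Matrix μ μ 𝕜) * Q) Q).det := by rwa [e]
  have h := minOp_eq_tilt H Q 1 hK' hP'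
  rw [e, add_comm (effForm H Q) (1 : Matrix μ μ 𝕜)] at h
  exact h

/-- [folklore] **`Γ = G − G Qᵀ (1 + 𝔊) Q G`**: `flucCov H Q = (H + QᵀQ)⁻¹ − (H + QᵀQ)⁻¹·Qᵀ·(1 + effForm H Q)·Q·(H + QᵀQ)⁻¹`. -/
theorem flucCov_eq_tilt_one (H : Matrix ν ν 𝕜) (Q : Matrix μ ν 𝕜)
    (hK : IsUnit (H + Qᵀ * Q).det) (hP : IsUnit (blockProp (H + Qᵀ * Q) Q).det) :
    flucCov H Q = (H + Qᵀ * Q)⁻¹ - (H + Qᵀ * Q)⁻¹ * Qᵀ * (1 + effForm H Q) * Q * (H + Qᵀ * Q)⁻¹ := by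
  have e : H + Qᵀ * (1 : Matrix μ μ 𝕜) * Q = H + Qᵀ * Q := by rw [Matrix.mul_one]
  have hK' : IsUnit (H + Qᵀ * (1 : Matrix μ μ 𝕜) * Q).det := by rwa [e]
  have hP' : IsUnit (blockProp (H + Qᵀ * (1 : Matrix μ μ 𝕜) * Q) Q).det := by rwa [e]
  have h := flucCov_eq_tilt H Q 1 hK' hP'
  rw [e, add_comm (effForm H Q) (1 : Matrix μ μ 𝕜)] at h
  exact h

end Summit.QuantumFields.BalabanUV.Beta.FP.TiltDictionary

end
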